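import Summits.Ventures.CertifiedManyBodySolver.Observables.PairLROTowerChargedBracket
import Literature.MathematicalPhysics.QuantumLattice.HubbardTTPrimeWindowCertificateAbstractState
import HarnessLib

/-!
# OP1-C, part 6: the interval-slack input `hWq` in OPERATOR-NORM form (producer/reader convention (a))

HONEST FRAMING: first certified bounds on pairing observables; not a superconductivity verdict; a ceiling route,
never presence. Crew hubbard-obs (D-0042), seat hubbard-obs-p1 (`prover-hubbard-obs-p1-g9-0`); lead RULING (ex1)
d190 (convention (a) of sr-mbsolver-menu-3 g2's reading (R1)). Zero compute; no definition; no named fact; no `sorry`.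

The grid theorem `liminf_pairFieldLRO_le_sq_of_onePoint_chargedStationary_bound_TT'_near`
(PairLROTowerChargedBracket) prices the distance `Δ` between the grid chemical potential `μ'` and a supporting
slope by the INTERVAL SLACK `Δ·C_q`, where `C_q` is any uniform bound
`|Re⟨ζ,(N̂W_L − W_LN̂)ζ⟩| ≤ C_q·L²` (`hWq`). PairLROTowerChargedNumber discharged `hWq` with the ENTRYWISE constant
`Σ_{s,t}|(N̂₀w − wN̂₀)_{st}|` (`= 4`, not `1`, for the nearest-neighbour pair word on its bond). The Stage-B cell
certificates book `B_X = ‖X‖_op ≤ 1` per normal-ordered generator word `X` (two `le` rows per generator inside the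
SDP), so the reader needs the OPERATOR-NORM form, supplied here:

* `norm_fermionEmbed_le` — `‖Γ(φ) a‖ ≤ ‖a‖` (a `*`-homomorphism of finite-dimensional C⋆-algebras is contractive);
* `norm_expect_le_opNorm`, `norm_torusAvgExpectAt_le_opNorm` — `|⟨ψ, D ψ⟩| ≤ ‖D‖` and
  `‖torusAvgExpectAt L Ω D ψ‖ ≤ ‖D‖` for unit `ψ` (the translation-averaged vector state is a state);
* **`abs_re_expect_totalNumber_commutator_translationSum_le_opNorm`** — `hWq` with
  `C_q = ‖N̂₀w − wN̂₀‖_op`; `…_of_charge` — `= |q|·‖w‖` for `N̂₀w − wN̂₀ = −q·w`;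
* `norm_totalNumberOp_commutator_sum_smul_le` — for a multiplier-weighted combination `w = Σ_i c_i • X_i` of
  generators of charges `q_i` (`N̂₀X_i − X_iN̂₀ = q_i • X_i`) with `‖X_i‖ ≤ B_i`:
  `‖N̂₀w − wN̂₀‖ ≤ Σ_i ‖c_i‖·|q_i|·B_i` — the producer's `C_q = Σ_X |λ_X|·|q_X|·B_X`;
* `totalNumberOp_commutator_ladderWord`, `norm_totalNumberOp_commutator_sum_smul_ladderWord_le` — every
  normal-ordered monomial (ladder word) `W` has `N̂₀W − WN̂₀ = q(W) • W`, `q(W) = #creators − #annihilators`,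
  and `‖W‖ ≤ 1` (`norm_ladderWord_le_one`), so `B_X = 1` for single-word generators.

References: O. Bratteli, D. W. Robinson, *Operator Algebras and Quantum Statistical Mechanics 1* (1987),
Prop. 2.3.11 and *2* (1997) §5.2.2 [BratteliRobinsonI1987] [BratteliRobinsonII1997]; T. Koma, H. Tasaki,
J. Stat. Phys. 76 (1994) 745, §2 [KomaTasaki1994].
-/

noncomputable section

namespace Summit.Ventures.CertifiedManyBodySolver.Observables

open Matrix Complex Finset Literature.MathematicalPhysics.QuantumLattice Literature.Probability.LatticeModels
open Literature.MathematicalPhysics.QuantumLattice.HubbardWave0 ThermodynamicLimit Filter Topology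
open scoped ComplexOrder ComplexConjugate BigOperators Matrix.Norms.L2Operator

/-! ### §1  Contractivity of `Γ(φ)` and of (averaged) vector states in the operator norm -/

section OpNorm

variable {Λ Λ' : Type*} [LinearOrder Λ] [Fintype Λ] [LinearOrder Λ'] [Fintype Λ']

/-- **`‖Γ(φ) a‖ ≤ ‖a‖`**: the embedding `Γ(φ) : 𝔄(Λ) → 𝔄(Λ')` of local CAR algebras is a unital
`*`-homomorphism of finite-dimensional C⋆-algebras (`fermionEmbed_conjTranspose`), hence contractive.
[cite: BratteliRobinsonII1997, §5.2.2] [cite: BratteliRobinsonI1987, Prop. 2.3.11] -/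
theorem norm_fermionEmbed_le (φ : Λ ↪ Λ') (a : Matrix (Finset (Orb Λ)) (Finset (Orb Λ)) ℂ) :
    ‖fermionEmbed φ a‖ ≤ ‖a‖ := by
  letI : CStarAlgebra (Matrix (Finset (Orb Λ)) (Finset (Orb Λ)) ℂ) := {}
  letI : CStarAlgebra (Matrix (Finset (Orb Λ')) (Finset (Orb Λ')) ℂ) := {}
  let Φ : Matrix (Finset (Orb Λ)) (Finset (Orb Λ)) ℂ →⋆ₐ[ℂ] Matrix (Finset (Orb Λ')) (Finset (Orb Λ')) ℂ :=
    StarAlgHom.mk (fermionEmbed φ) fun x => by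
      change fermionEmbed φ (star x) = star (fermionEmbed φ x)
      rw [Matrix.star_eq_conjTranspose, Matrix.star_eq_conjTranspose, fermionEmbed_conjTranspose]
  exact NonUnitalStarAlgHom.norm_apply_le Φ a

variable {ι : Type*} [LinearOrder ι] [Fintype ι]

/-- `|⟨ψ, D ψ⟩| ≤ ‖D‖` for a unit vector `ψ` (vector states are states). [cite: BratteliRobinsonI1987, Prop. 2.3.11] -/
theorem norm_expect_le_opNorm {ψ : Fock ι} (hψ : star ψ ⬝ᵥ ψ = 1) (D : Matrix (Finset ι) (Finset ι) ℂ) :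
    ‖expect D ψ‖ ≤ ‖D‖ := by
  unfold Literature.MathematicalPhysics.QuantumLattice.expect
  refine (norm_star_dotProduct_le_eucNorm hψ _).trans ?_
  have h := eucNorm_mulVec_le D ψ
  rwa [eucNorm_eq_one hψ, mul_one] at h

end OpNorm

section TorusAverage

variable {d : ℕ} {L : ℕ} [NeZero L]

/-- **`‖torusAvgExpectAt L Ω D ψ‖ ≤ ‖D‖` for a unit vector `ψ`**: the translation-averaged vector state of the
torus is a state, hence contractive in the operator norm of the local algebra `𝔄_Ω` (each translate `U_v ψ` is a
unit vector, `|⟨U_vψ, Γ(ι)D U_vψ⟩| ≤ ‖Γ(ι)D‖ ≤ ‖D‖`). The operator-norm sharpening of the entrywise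
`norm_torusAvgExpectAt_le_sum_norm`. [cite: BratteliRobinsonI1987, Prop. 2.3.11] -/
theorem norm_torusAvgExpectAt_le_opNorm (Ω : Finset (Site d)) (D : FermionOp Ω)
    {ψ : Fock (Orb (FermionTorus d L))} (hψ : star ψ ⬝ᵥ ψ = 1) :
    ‖torusAvgExpectAt L Ω D ψ‖ ≤ ‖D‖ := by
  by_cases h : Set.InjOn (Torus.proj (d := d) L) ↑Ω
  · rw [torusAvgExpectAt_of_injOn L h]
    have hcard : (0 : ℝ) < (Fintype.card (TorusSite d L) : ℝ) := Nat.cast_pos.2 Fintype.card_pos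
    have hterm : ∀ v : TorusSite d L,
        ‖expect (fermionEmbed (PolySite.toTorusEmb L h) D) ((fockTranslate v).val *ᵥ ψ)‖ ≤ ‖D‖ := by
      intro v
      have hv : star ((fockTranslate v).val *ᵥ ψ) ⬝ᵥ ((fockTranslate v).val *ᵥ ψ) = 1 := by
        rw [star_fockRelabel_mulVec_dotProduct, hψ]
      exact (norm_expect_le_opNorm hv _).trans (norm_fermionEmbed_le _ D)
    rw [norm_mul, norm_inv, Complex.norm_natCast]
    calc (Fintype.card (TorusSite d L) : ℝ)⁻¹ *
          ‖∑ v : TorusSite d L, expect (fermionEmbed (PolySite.toTorusEmb L h) D) ((fockTranslate v).val *ᵥ ψ)‖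
        ≤ (Fintype.card (TorusSite d L) : ℝ)⁻¹ * ∑ _v : TorusSite d L, ‖D‖ :=
          mul_le_mul_of_nonneg_left ((norm_sum_le _ _).trans (Finset.sum_le_sum fun v _ => hterm v))
            (inv_nonneg.2 hcard.le)
      _ = ‖D‖ := by
          rw [Finset.sum_const, Finset.card_univ, nsmul_eq_mul, ← mul_assoc, inv_mul_cancel₀ hcard.ne', one_mul]
  · rw [torusAvgExpectAt_of_not_injOn L h, norm_zero]
    exact norm_nonneg D

end TorusAverage

/-! ### §2  `hWq` in operator-norm form -/

section ChargeOnePointOpNorm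

variable {L : ℕ} [NeZero L] {Λb : Finset (Site 2)}

/-- **The one-point size of the charge of `W_L`, OPERATOR-NORM form** (the input `hWq` of
`liminf_pairFieldLRO_le_sq_of_onePoint_chargedStationary_bound_TT'_near`, producer/reader convention (a)):
`N̂W_L − W_LN̂` is the translation sum of the local word `N̂₀w − wN̂₀`, so for every unit `ζ`
`|Re⟨ζ,(N̂W_L − W_LN̂)ζ⟩| ≤ ‖N̂₀w − wN̂₀‖_op·L²`. [cite: BratteliRobinsonI1987, Prop. 2.3.11]
[cite: BratteliRobinsonII1997, §5.2.2] -/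
theorem abs_re_expect_totalNumber_commutator_translationSum_le_opNorm
    (h : Set.InjOn (Torus.proj (d := 2) L) ↑Λb) (wloc : FermionOp Λb)
    (ζ : Fock (Orb (FermionTorus 2 L))) (hζ : star ζ ⬝ᵥ ζ = 1) :
    |(star ζ ⬝ᵥ ((totalNumber *
        (∑ v : TorusSite 2 L, relabel (Orb.translate v) (fermionEmbed (PolySite.toTorusEmb L h) wloc)) -
      (∑ v : TorusSite 2 L, relabel (Orb.translate v) (fermionEmbed (PolySite.toTorusEmb L h) wloc)) *
        totalNumber) *ᵥ ζ)).re| ≤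
      ‖(totalNumberOp * wloc - wloc * totalNumberOp : FermionOp Λb)‖ * (L : ℝ) ^ 2 := by
  set cw : FermionOp Λb := (totalNumberOp : FermionOp Λb) * wloc - wloc * totalNumberOp with hcw
  have hloc : (totalNumber : Matrix (Finset (Orb (FermionTorus 2 L))) (Finset (Orb (FermionTorus 2 L))) ℂ) *
      fermionEmbed (PolySite.toTorusEmb L h) wloc - fermionEmbed (PolySite.toTorusEmb L h) wloc * totalNumber =
      fermionEmbed (PolySite.toTorusEmb L h) cw := by
    rw [← totalNumberOp_eq_totalNumber, totalNumberOp_commutator_fermionEmbed]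
  have hT : ∀ v : TorusSite 2 L, relabel (Orb.translate v)
      (totalNumber : Matrix (Finset (Orb (FermionTorus 2 L))) (Finset (Orb (FermionTorus 2 L))) ℂ) = totalNumber :=
    fun v => by rw [Orb.translate, relabel_mapEquiv_totalNumber]
  have hsum : totalNumber *
        (∑ v : TorusSite 2 L, relabel (Orb.translate v) (fermionEmbed (PolySite.toTorusEmb L h) wloc)) -
      (∑ v : TorusSite 2 L, relabel (Orb.translate v) (fermionEmbed (PolySite.toTorusEmb L h) wloc)) * totalNumber =
      ∑ v : TorusSite 2 L, relabel (Orb.translate v) (fermionEmbed (PolySite.toTorusEmb L h) cw) := by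
    rw [Finset.mul_sum, Finset.sum_mul, ← Finset.sum_sub_distrib]
    refine Finset.sum_congr rfl fun v _ => ?_
    rw [← hT v, ← relabel_mul, ← relabel_mul, ← relabel_sub, hloc]
  have hexp : star ζ ⬝ᵥ ((∑ v : TorusSite 2 L, relabel (Orb.translate v)
      (fermionEmbed (PolySite.toTorusEmb L h) cw)) *ᵥ ζ) = ((L : ℂ) ^ 2) * torusAvgExpectAt L Λb cw ζ :=
    expect_sum_relabel_translate_fermionEmbed' L h cw ζ
  rw [hsum, hexp]
  have hnorm : ‖torusAvgExpectAt L Λb cw ζ‖ ≤ ‖cw‖ := norm_torusAvgExpectAt_le_opNorm Λb cw hζ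
  calc |(((L : ℂ) ^ 2) * torusAvgExpectAt L Λb cw ζ).re|
      ≤ ‖((L : ℂ) ^ 2) * torusAvgExpectAt L Λb cw ζ‖ := Complex.abs_re_le_norm _
    _ = (L : ℝ) ^ 2 * ‖torusAvgExpectAt L Λb cw ζ‖ := by rw [norm_mul, norm_pow, Complex.norm_natCast]
    _ ≤ (L : ℝ) ^ 2 * ‖cw‖ := mul_le_mul_of_nonneg_left hnorm (by positivity)
    _ = ‖cw‖ * (L : ℝ) ^ 2 := mul_comm _ _

/-- **`hWq` for a word of definite charge, operator-norm form**: if `N̂₀w − wN̂₀ = −q·w` then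
`|Re⟨ζ,(N̂W_L − W_LN̂)ζ⟩| ≤ (|q|·‖w‖_op)·L²` — e.g. `2‖w‖` for a pair word, and `‖w‖ ≤ 1` for a single
normal-ordered monomial (`norm_ladderWord_le_one`). [cite: BratteliRobinsonII1997, §5.2.2] -/
theorem abs_re_expect_totalNumber_commutator_translationSum_le_opNorm_of_charge
    (h : Set.InjOn (Torus.proj (d := 2) L) ↑Λb) (wloc : FermionOp Λb) {q : ℝ}
    (hq : (totalNumberOp : FermionOp Λb) * wloc - wloc * totalNumberOp = -((q : ℂ) • wloc))
    (ζ : Fock (Orb (FermionTorus 2 L))) (hζ : star ζ ⬝ᵥ ζ = 1) :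
    |(star ζ ⬝ᵥ ((totalNumber *
        (∑ v : TorusSite 2 L, relabel (Orb.translate v) (fermionEmbed (PolySite.toTorusEmb L h) wloc)) -
      (∑ v : TorusSite 2 L, relabel (Orb.translate v) (fermionEmbed (PolySite.toTorusEmb L h) wloc)) *
        totalNumber) *ᵥ ζ)).re| ≤
      (|q| * ‖wloc‖) * (L : ℝ) ^ 2 := by
  refine (abs_re_expect_totalNumber_commutator_translationSum_le_opNorm h wloc ζ hζ).trans
    (mul_le_mul_of_nonneg_right (le_of_eq ?_) (by positivity))
  rw [hq, norm_neg, norm_smul, Complex.norm_real, Real.norm_eq_abs]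

end ChargeOnePointOpNorm

/-! ### §3  The producer's constant `C_q = Σ_X |λ_X|·|q_X|·B_X` -/

section Generators

variable {ι : Type*} [LinearOrder ι] [Fintype ι]

/-- **`‖N̂₀w − wN̂₀‖ ≤ Σ_i ‖c_i‖·|q_i|·B_i` for a multiplier-weighted combination `w = Σ_i c_i • X_i` of
generators of definite charges** (`N̂₀X_i − X_iN̂₀ = q_i • X_i`, `‖X_i‖ ≤ B_i`): the constant `C_q` of the
Stage-B cell certificates (two `le` rows per charged generator with operator-norm-type `B_X`).
[cite: BratteliRobinsonII1997, §5.2.2] [cite: KomaTasaki1994, §2] -/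
theorem norm_totalNumberOp_commutator_sum_smul_le {κ : Type*} (s : Finset κ) (c : κ → ℂ)
    (X : κ → Matrix (Finset ι) (Finset ι) ℂ) (q : κ → ℂ) (B : κ → ℝ)
    (hq : ∀ i ∈ s, totalNumberOp * X i - X i * totalNumberOp = q i • X i) (hB : ∀ i ∈ s, ‖X i‖ ≤ B i) :
    ‖totalNumberOp * (∑ i ∈ s, c i • X i) - (∑ i ∈ s, c i • X i) * totalNumberOp‖ ≤
      ∑ i ∈ s, ‖c i‖ * ‖q i‖ * B i := by
  have hsum : totalNumberOp * (∑ i ∈ s, c i • X i) - (∑ i ∈ s, c i • X i) * totalNumberOp =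
      ∑ i ∈ s, (c i * q i) • X i := by
    rw [Finset.mul_sum, Finset.sum_mul, ← Finset.sum_sub_distrib]
    refine Finset.sum_congr rfl fun i hi => ?_
    rw [Matrix.mul_smul, Matrix.smul_mul, ← smul_sub, hq i hi, smul_smul]
  rw [hsum]
  refine (norm_sum_le _ _).trans (Finset.sum_le_sum fun i hi => ?_)
  rw [norm_smul, norm_mul]
  exact mul_le_mul_of_nonneg_left (hB i hi) (by positivity)

/-- **The charge of a normal-ordered monomial**: for a ladder word `W = a₁⋯a_k` (each `a_j` a `c†` or a `c`),
`N̂₀W − WN̂₀ = q(W) • W` with `q(W) = #creators − #annihilators` (`ladderCharge`).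
[cite: BratteliRobinsonII1997, §5.2.2] -/
theorem totalNumberOp_commutator_ladderWord (l : List (ι × Bool)) :
    totalNumberOp * (ladderWord l : Matrix (Finset ι) (Finset ι) ℂ) - ladderWord l * totalNumberOp =
      ((ladderCharge l : ℤ) : ℂ) • ladderWord l := by
  -- entrywise: `W s t ≠ 0 ⇒ #s = #t + q(W)` (the word maps the `#t`-sector to the `#t + q`-sector)
  have hsector : ∀ s t : Finset ι, (ladderWord l : Matrix (Finset ι) (Finset ι) ℂ) s t ≠ 0 →
      (s.card : ℤ) = (t.card : ℤ) + ladderCharge l := by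
    intro s t hst
    have ht : IsZParticle (t.card : ℤ) (Pi.single t (1 : ℂ) : Fock ι) := by
      intro s' hs'
      rw [Pi.single_apply]
      split_ifs with h
      · exact absurd (by rw [h]) hs'
      · rfl
    have h := IsZParticle.ladderWord_mulVec ht l
    by_contra hne
    have h0 := h s hne
    rw [Matrix.mulVec_single_one] at h0
    exact hst h0
  ext s t
  rw [Matrix.sub_apply, totalNumberOp_eq_diagonal, diagonal_mul, mul_diagonal, Matrix.smul_apply, smul_eq_mul]
  by_cases hst : (ladderWord l : Matrix (Finset ι) (Finset ι) ℂ) s t = 0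
  · rw [hst, mul_zero, zero_mul, mul_zero, sub_zero]
  · have hc := hsector s t hst
    rw [mul_comm ((ladderWord l : Matrix (Finset ι) (Finset ι) ℂ) s t), ← sub_mul]
    congr 1
    have : ((s.card : ℤ) : ℂ) = ((t.card : ℤ) : ℂ) + ((ladderCharge l : ℤ) : ℂ) := by exact_mod_cast hc
    push_cast at this ⊢
    linear_combination this

/-- **`C_q = Σ_X |λ_X|·|q(X)|` for a combination of single-word generators**: for `w = Σ_i c_i • W_i` with
ladder words `W_i`, `‖N̂₀w − wN̂₀‖ ≤ Σ_i ‖c_i‖·|q(W_i)|` (`B_X = 1` by `norm_ladderWord_le_one`).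
[cite: BratteliRobinsonII1997, §5.2.2] -/
theorem norm_totalNumberOp_commutator_sum_smul_ladderWord_le {κ : Type*} (s : Finset κ) (c : κ → ℂ)
    (l : κ → List (ι × Bool)) :
    ‖totalNumberOp * (∑ i ∈ s, c i • (ladderWord (l i) : Matrix (Finset ι) (Finset ι) ℂ)) -
        (∑ i ∈ s, c i • (ladderWord (l i) : Matrix (Finset ι) (Finset ι) ℂ)) * totalNumberOp‖ ≤
      ∑ i ∈ s, ‖c i‖ * |(ladderCharge (l i) : ℝ)| := by
  have h := norm_totalNumberOp_commutator_sum_smul_le s c (fun i => (ladderWord (l i) : Matrix (Finset ι) (Finset ι) ℂ))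
    (fun i => ((ladderCharge (l i) : ℤ) : ℂ)) (fun _ => 1)
    (fun i _ => totalNumberOp_commutator_ladderWord (l i)) (fun i _ => norm_ladderWord_le_one (l i))
  refine h.trans (le_of_eq (Finset.sum_congr rfl fun i _ => ?_))
  rw [mul_one, Complex.norm_intCast]

end Generators

end Summit.Ventures.CertifiedManyBodySolver.Observables

end
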